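import Summits.HodgeConjecture.HodgeConjecture.Theorems.F0P3XiArchDataOfRecord     -- K6 part 1 (p01 g8): `archTypeOfRecord`, `sgnInfOfRecord`, `isCohTrivialAt_of_mk_eq`
import Summits.HodgeConjecture.HodgeConjecture.Theorems.F0P3bArchDegOneClass       -- ★ p820619 (X1′): `archDegOneClass`, `archDegOneClass_spec`, `eq_of_ofModule_eq_archDegOneClass`
import Literature.RepresentationTheory.BorelWallach2000.UpqTypeFunctoriality       -- ★ `upqTypeClasses_eq_bot_iff_of_equiv` (types along `(𝔤,K)`-equivalences)
import Literature.NumberTheory.Rogawski1990.LocalAPacket                           -- ★ `LocalAPacket`, `members`, `members_of_πs_eq_some`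
import HarnessLib

/-!
# THE ARCHIMEDEAN PACKET OF RECORD `packInf₀` for the T5 kit `𝔠₀` — `Π(ξ_ι)` as a function of print's three integers `(p, q, t)`,
# with the `H¹`-member NAMED on the cohomological locus, and the laws `ArchPacketCoh` ∕ `ArchMember` AT IT

Cell `hodgecm-mathlib`, F0∕P3 «U3-mult», crux H413 (`stmt-HodgeConjecture-24833`), rung 4; F0P3-p01 (g8), K6 part 2 (PLAN.F0P3g5 §5 K6, RULING (V33)(1)–(2)
as CORRECTED by p01's stop-check 10:52:34Z).  DEF LANE: two definitions (`archPacketAt`, `archPacketOfRecord`) + two residual PREDICATES on the posited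
carriers (`JInfNoDegOne`, `DsInfNoDegOne`) + theorems; no instance, no notation, no named fact, no `sorry`.

PRINT [Rogawski1990 §12.3 pp. 174–178, Prop. 12.3.3; §13.1 p. 199; Prop. 15.2.1 p. 249].  At the real place under `ι` the component `ξ_ι` of a
one-dimensional automorphic `ξ = (η∘det₀)(ψ∘det)` of `H` IS the pair of exponents `(p, q) = (ξ.pη ι, ξ.qψ ι)` (`η_ι(u) = u^p`, `ψ_ι(u) = u^q`), and with
Rogawski's parameter `t` of `μω` at `ι` (`μ_ι(z) = (z/z̄)^{t+1/2}`; of record: `t = tOfArchType k₀ ι`, ★ `archTypeOfRecord`) the archimedean A-packet is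
`Π(ξ_ι) = {πⁿ(ξ_ι), πˢ(ξ_ι)} = {J^±_φ, D^∓_φ}` (`π²_φ` in the degenerate case), `φ = φ(a,b,c) = rogTriple p q t` (★ `ArchSignRecipe.rogTriple`), the sign
being Rogawski's label `rogSign p t` (★).  `J^±_φ` carries (𝔤,K)-cohomology in degree one WITH TRIVIAL COEFFICIENTS iff `φ = φ(1,0,−1)` iff
★ `IsCohTrivial p q t` [Prop. 15.2.1 (b) + Wigner's lemma, BorelWallach2000 I.5.3: for `φ ≠ φ(1,0,−1)` the infinitesimal character of `J_φ` is that of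
`F_φ ≠ 𝟙`]; `D_φ` never does [Prop. 15.2.1 (a): discrete series have `H^j = 0`, `j ≠ 2`].

THE PACKET OF RECORD (§1–§2).  `archPacketAt jInf dsInf p q t := ⟨πn := if IsCohTrivial p q t then archDegOneClass (rogSign p t) ‹±1› else jInf p q t,
πs := some (dsInf p q t)⟩` and `packInf₀ ξ := archPacketOfRecord ι μω jInf dsInf ξ := archPacketAt jInf dsInf (ξ.pη ι) (ξ.qψ ι) (tOfArchType k₀ ι)`:
* ON THE COHOMOLOGICAL LOCUS the non-tempered member is NAMED — ★ X1′ `archDegOneClass (sgnInf₀ ξ)`, the canonical class of the irreducible unitary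
  cohomological `(𝔲(2,1),K)`-module with a degree-one class of type `sgnInf₀ ξ = rogSign p t = q` (★ `sgnInfOfRecord`; `…_πn_of_isCohTrivialAt`);
* OFF IT, and for `πˢ` everywhere, the members are POSITED: `jInf dsInf : ℤ → ℤ → ℤ → Cinf` are two PARAMETERS of the ED. 4 closer (the classes of
  `J^±_φ`, `φ ≠ φ(1,0,−1)`, and of `D^∓_φ ∕ π²_φ` — not constructed in the tree), `L`-INDEPENDENT (so `𝔎₀` stays a closed `KitFamily` under road (i)) and
  indexed by exactly print's data `(p,q,t)`; `πs` is NEVER `none` (REF1 R-22).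
WHY NOT the unconditional `πn := archDegOneClass (sgnInf₀ ξ)` of RULING (V33)(1): for a NON-cohomological `ξ` (e.g. `ξ = 𝟙`, `q = 0`) it puts an
`H¹`-member into `Π(ξ_ι)`, and the law `ArchMember` at `𝔠₀` then concludes `ξ.IsCohTrivialAt …` for every `ξ` — refutable (p01 (g8) stop-check 10:52:34Z).

THE LAWS AT `packInf₀` (§3–§4).  Two residual clauses on the parameters — `JInfNoDegOne jInf` («off the locus `jInf p q t` has no non-zero degree-one class
of type `±1`») and `DsInfNoDegOne dsInf` («`dsInf p q t` never has one») — are exactly what print says about `J_φ` (`φ ≠ φ₀`) and `D_φ` [Prop. 15.2.1]; they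
ride the rung-0 existential with (L6).  GIVEN THEM: **`archPacketCoh_of`** = the body of T5 v5's law `ArchPacketCoh` at (`packInf₀`, `sgnInf₀`) (the `πn`
case on the locus is X1′ rigidity `eq_of_ofModule_eq_archDegOneClass` after transporting `upqTypeClasses ≠ ⊥` along the `(𝔤,K)`-equivalence to the
representative, ★ `upqTypeClasses_eq_bot_iff_of_equiv`); **`archMember_of`** = the body of law `ArchMember μω` at `packInf₀` (the `πn` case on the locus
needs NO module argument: the guard is the conclusion at `ι`, and at `ῑ` by ★ `isCohTrivialAt_of_mk_eq`, the closer's `k` being `k₀` by ★ `archTypeOfRecord_eq`).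
So rows 17–18 of PLAN.F0P3g5 §1 cost the two clauses and NO separate letter.

References: [Rogawski1990] §12.3 pp. 174–178 (Prop. 12.3.3, `J^±_φ`, `(p,q,t) ↦ (−p,−q,−t−1)`), §13.1 p. 199, Prop. 15.2.1 p. 249; [BorelWallach2000] I §5.3
(Wigner), II §4, VI Thm. 4.11; [KnappVogan1995] §II.4 (infinitesimal equivalence classes).
HC_CM is proved only modulo the printed citations until rung 0 closes.
-/

set_option autoImplicit false
set_option linter.dupNamespace false

noncomputable section

open NumberField
open scoped Classical

namespace Summit.HodgeConjecture.HodgeConjecture.Cruxes.H413.F0P3XiArchPacketOfRecord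

open Literature.NumberTheory.Rogawski1990 Literature.NumberTheory.GaloisRepresentations Literature.NumberTheory.Automorphic
open Literature.RepresentationTheory.BorelWallach2000 Literature.RepresentationTheory.KonnoKonno2007
open Summit.HodgeConjecture.HodgeConjecture.Cruxes.H413.F0P3bArchDegOneClass (archDegOneClass archDegOneClass_spec eq_of_ofModule_eq_archDegOneClass)
open Summit.HodgeConjecture.HodgeConjecture.Cruxes.H413.F0P3XiArchDataOfRecord

-- Mathlib idiom (as in ★ `GKModuleIrrClass`, the `Upq*` files, X1′, T5): commutator bracket on `Module.End`
attribute [local instance 100] LieRing.ofAssociativeRing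

/-! ## §1 The archimedean packet as a function of print's `(p, q, t)` -/

/-- `archDegOneClass δ _` does not depend on the proof of `δ = ±1`, nor on the syntactic form of `δ`. [cite: Rogawski1990, §12.3 p. 178] -/
theorem archDegOneClass_congr {δ δ' : ℤ} (h : δ = δ') (hδ : δ = 1 ∨ δ = -1) (hδ' : δ' = 1 ∨ δ' = -1) :
    archDegOneClass δ hδ = archDegOneClass δ' hδ' := by
  subst h
  rfl

/-- **`Π(p,q,t)` — the archimedean A-packet at the parameters `(p, q, t)` of `ξ_ι` and `μ_ι`** [§12.3 p. 178: `Π(ξ_ι) = {πⁿ, πˢ}`, `πⁿ = J^±_φ`,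
`φ = φ(a,b,c) = rogTriple p q t`]: ON the cohomological locus `IsCohTrivial p q t` (`φ = φ(1,0,−1)`) the non-tempered member is the NAMED class ★
`archDegOneClass (rogSign p t)` (X1′); OFF it `πⁿ := jInf p q t`, and `πˢ := dsInf p q t` always — `jInf`, `dsInf` the POSITED classes of `J^±_φ`
(`φ ≠ φ(1,0,−1)`) and of `D^∓_φ ∕ π²_φ`. [cite: Rogawski1990, §12.3 p. 178, Prop. 12.3.3] -/
def archPacketAt (jInf dsInf : ℤ → ℤ → ℤ → GKIrrClass (uFormGroup (Fin 2) (Fin 1))) (p q t : ℤ) :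
    LocalAPacket (GKIrrClass (uFormGroup (Fin 2) (Fin 1))) where
  πn := if ArchSignRecipe.IsCohTrivial p q t then
      archDegOneClass (ArchSignRecipe.rogSign p t) (ArchSignRecipe.rogSign_eq_one_or_eq_neg_one p t)
    else jInf p q t
  πs := some (dsInf p q t)

variable (jInf dsInf : ℤ → ℤ → ℤ → GKIrrClass (uFormGroup (Fin 2) (Fin 1)))

/-- On the cohomological locus `πⁿ = [J^{rogSign p t}]`. [cite: Rogawski1990, §12.3 p. 178, Prop. 12.3.3] -/
theorem archPacketAt_πn_of {p q t : ℤ} (h : ArchSignRecipe.IsCohTrivial p q t) :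
    (archPacketAt jInf dsInf p q t).πn =
      archDegOneClass (ArchSignRecipe.rogSign p t) (ArchSignRecipe.rogSign_eq_one_or_eq_neg_one p t) :=
  if_pos h

/-- On the cohomological locus `πⁿ = [J^{q}]` (the sign is `q`, ★ `rogSign_eq_of_isCohTrivial`). [cite: Rogawski1990, §12.3 p. 178] -/
theorem archPacketAt_πn_eq_archDegOneClass_q {p q t : ℤ} (h : ArchSignRecipe.IsCohTrivial p q t) :
    (archPacketAt jInf dsInf p q t).πn = archDegOneClass q (ArchSignRecipe.q_eq_one_or_eq_neg_one_of_isCohTrivial h) := by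
  rw [archPacketAt_πn_of jInf dsInf h]
  exact archDegOneClass_congr (ArchSignRecipe.rogSign_eq_of_isCohTrivial h) _ _

/-- Off the cohomological locus `πⁿ = jInf p q t` (posited `[J_φ]`, `φ ≠ φ(1,0,−1)`). [cite: Rogawski1990, §12.3 p. 178] -/
theorem archPacketAt_πn_of_not {p q t : ℤ} (h : ¬ ArchSignRecipe.IsCohTrivial p q t) :
    (archPacketAt jInf dsInf p q t).πn = jInf p q t :=
  if_neg h

/-- `πˢ = dsInf p q t` — never `none` at a real place where `G′_v = U(2,1)` (REF1 R-22). [cite: Rogawski1990, §12.3 p. 178; §14.6 p. 244] -/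
theorem archPacketAt_πs (p q t : ℤ) : (archPacketAt jInf dsInf p q t).πs = some (dsInf p q t) :=
  rfl

/-- The members: `{πⁿ, dsInf p q t}`. [cite: Rogawski1990, §13.1 p. 199] -/
theorem archPacketAt_members (p q t : ℤ) :
    (archPacketAt jInf dsInf p q t).members = {(archPacketAt jInf dsInf p q t).πn, dsInf p q t} :=
  LocalAPacket.members_of_πs_eq_some _ (archPacketAt_πs jInf dsInf p q t)

/-- Membership unfolded. [cite: Rogawski1990, §13.1 p. 199] -/
theorem mem_archPacketAt_iff (p q t : ℤ) (x : GKIrrClass (uFormGroup (Fin 2) (Fin 1))) :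
    x ∈ (archPacketAt jInf dsInf p q t).members ↔ x = (archPacketAt jInf dsInf p q t).πn ∨ x = dsInf p q t := by
  rw [archPacketAt_members, Set.mem_insert_iff, Set.mem_singleton_iff]

/-! ## §2 `packInf₀ = archPacketOfRecord ι μω jInf dsInf` -/

variable {L : Type} [Field L] [NumberField L] [IsCMField L]

/-- **`packInf₀ ξ := Π(ξ.pη ι, ξ.qψ ι, tOfArchType k₀ ι)`** — the archimedean packet of record of `ξ` at the frame's `ι`, at the type of record `k₀` of
`μω` (★ `archTypeOfRecord`).  The kit field `packInf : OneDimAutRepH L → LocalAPacket Cinf` of `𝔠₀`. [cite: Rogawski1990, §12.3 p. 178, Prop. 12.3.3; §13.1 p. 199] -/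
def archPacketOfRecord (ι : L →+* ℂ) (μω : HeckeCharacter L) (jInf dsInf : ℤ → ℤ → ℤ → GKIrrClass (uFormGroup (Fin 2) (Fin 1)))
    (ξ : OneDimAutRepH L) : LocalAPacket (GKIrrClass (uFormGroup (Fin 2) (Fin 1))) :=
  archPacketAt jInf dsInf (ξ.pη ι) (ξ.qψ ι) (ArchSignRecipe.tOfArchType (archTypeOfRecord μω) ι)

variable (ι : L →+* ℂ) (μω : HeckeCharacter L)

/-- Unfolding. [cite: Rogawski1990, §12.3 p. 178] -/
theorem archPacketOfRecord_def (ξ : OneDimAutRepH L) :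
    archPacketOfRecord ι μω jInf dsInf ξ = archPacketAt jInf dsInf (ξ.pη ι) (ξ.qψ ι) (ArchSignRecipe.tOfArchType (archTypeOfRecord μω) ι) :=
  rfl

/-- **On the cohomological locus `πⁿ(ξ_ι) = [J^{sgnInf₀ ξ}]`** (= RULING (V33)(1)'s `archDegOneClass (sgnInf₀ ξ) ‹±1›`, there). [cite: Rogawski1990, §12.3 p. 178, Prop. 12.3.3] -/
theorem archPacketOfRecord_πn_of_isCohTrivialAt (ξ : OneDimAutRepH L)
    (h : ξ.IsCohTrivialAt (ArchSignRecipe.tOfArchType (archTypeOfRecord μω) ι) ι) :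
    (archPacketOfRecord ι μω jInf dsInf ξ).πn = archDegOneClass (sgnInfOfRecord ι μω ξ) (sgnInfOfRecord_eq_one_or_eq_neg_one ι μω ξ) :=
  archPacketAt_πn_of jInf dsInf h

/-- On the cohomological locus `πⁿ(ξ_ι) = [J^{q}]`, `q = ξ.qψ ι`. [cite: Rogawski1990, §12.3 p. 178] -/
theorem archPacketOfRecord_πn_eq_archDegOneClass_qψ (ξ : OneDimAutRepH L)
    (h : ξ.IsCohTrivialAt (ArchSignRecipe.tOfArchType (archTypeOfRecord μω) ι) ι) :
    (archPacketOfRecord ι μω jInf dsInf ξ).πn = archDegOneClass (ξ.qψ ι) (ArchSignRecipe.q_eq_one_or_eq_neg_one_of_isCohTrivial h) :=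
  archPacketAt_πn_eq_archDegOneClass_q jInf dsInf h

/-- Off the cohomological locus `πⁿ(ξ_ι) = jInf p q t`. [cite: Rogawski1990, §12.3 p. 178] -/
theorem archPacketOfRecord_πn_of_not (ξ : OneDimAutRepH L)
    (h : ¬ ξ.IsCohTrivialAt (ArchSignRecipe.tOfArchType (archTypeOfRecord μω) ι) ι) :
    (archPacketOfRecord ι μω jInf dsInf ξ).πn = jInf (ξ.pη ι) (ξ.qψ ι) (ArchSignRecipe.tOfArchType (archTypeOfRecord μω) ι) :=
  archPacketAt_πn_of_not jInf dsInf h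

/-- `πˢ(ξ_ι) = dsInf p q t`, never `none` (R-22). [cite: Rogawski1990, §12.3 p. 178; §14.6 p. 244] -/
theorem archPacketOfRecord_πs (ξ : OneDimAutRepH L) :
    (archPacketOfRecord ι μω jInf dsInf ξ).πs = some (dsInf (ξ.pη ι) (ξ.qψ ι) (ArchSignRecipe.tOfArchType (archTypeOfRecord μω) ι)) :=
  rfl

/-- Membership unfolded. [cite: Rogawski1990, §13.1 p. 199] -/
theorem mem_archPacketOfRecord_iff (ξ : OneDimAutRepH L) (x : GKIrrClass (uFormGroup (Fin 2) (Fin 1))) :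
    x ∈ (archPacketOfRecord ι μω jInf dsInf ξ).members ↔
      x = (archPacketOfRecord ι μω jInf dsInf ξ).πn ∨ x = dsInf (ξ.pη ι) (ξ.qψ ι) (ArchSignRecipe.tOfArchType (archTypeOfRecord μω) ι) :=
  mem_archPacketAt_iff jInf dsInf _ _ _ x

/-! ## §3 The residual clauses on the posited carriers (print-true constraints riding the rung-0 existential) -/

/-- **`JInfNoDegOne jInf`** — OFF the cohomological locus the posited class `jInf p q t` (`= [J_φ]`, `φ ≠ φ(1,0,−1)`) carries NO non-zero degree-one
`(𝔤,K)`-cohomology class of type `±1` (trivial coefficients): every irreducible module of that class has `H¹_δ = 0`. Print: the infinitesimal character of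
`J_φ` is that of `F_φ ≠ 𝟙`, so `H^*(𝔤,K; J_φ) = 0` (Wigner). [cite: Rogawski1990, Prop. 15.2.1 p. 249; BorelWallach2000, I §5.3] -/
def JInfNoDegOne (jInf : ℤ → ℤ → ℤ → GKIrrClass (uFormGroup (Fin 2) (Fin 1))) : Prop :=
  ∀ p q t : ℤ, ¬ ArchSignRecipe.IsCohTrivial p q t →
    ∀ (M : Type) [AddCommGroup M] [Module ℂ M]
      (σK : Representation ℂ (uFormGroup (Fin 2) (Fin 1)).maximalCompact M) (σ𝔤 : (uFormGroup (Fin 2) (Fin 1)).lie →ₗ⁅ℝ⁆ Module.End ℂ M)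
      (hM : IsGKModule (uFormGroup (Fin 2) (Fin 1)) σK σ𝔤) (hirr : IsIrreducibleGK σK σ𝔤),
      GKIrrClass.ofModule M σK σ𝔤 hM hirr = jInf p q t → ∀ δ : ℤ, (δ = 1 ∨ δ = -1) → upqTypeClasses σK σ𝔤 hM.ad_compat 1 δ = ⊥

/-- **`DsInfNoDegOne dsInf`** — the posited class `dsInf p q t` (`= [D^∓_φ]` ∕ `[π²_φ]`, the second member) carries NO non-zero degree-one class of type `±1`.
Print: discrete series have `H^j(𝔤,K; D ⊗ F^*) = 0` for `j ≠ 2`; off the locus Wigner again. [cite: Rogawski1990, Prop. 15.2.1 (a) p. 249; BorelWallach2000, VI Thm. 4.11, I §5.3] -/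
def DsInfNoDegOne (dsInf : ℤ → ℤ → ℤ → GKIrrClass (uFormGroup (Fin 2) (Fin 1))) : Prop :=
  ∀ (p q t : ℤ) (M : Type) [AddCommGroup M] [Module ℂ M]
    (σK : Representation ℂ (uFormGroup (Fin 2) (Fin 1)).maximalCompact M) (σ𝔤 : (uFormGroup (Fin 2) (Fin 1)).lie →ₗ⁅ℝ⁆ Module.End ℂ M)
    (hM : IsGKModule (uFormGroup (Fin 2) (Fin 1)) σK σ𝔤) (hirr : IsIrreducibleGK σK σ𝔤),
    GKIrrClass.ofModule M σK σ𝔤 hM hirr = dsInf p q t → ∀ δ : ℤ, (δ = 1 ∨ δ = -1) → upqTypeClasses σK σ𝔤 hM.ad_compat 1 δ = ⊥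

/-! ## §4 The laws `ArchPacketCoh` and `ArchMember` at (`packInf₀`, `sgnInf₀`) -/

/-- **The `πⁿ`-half on the locus, as a theorem (X1′ rigidity transported)**: a module of class `[J^s]` with a non-zero degree-one class of type `δ` has
`δ = s` — for ANY irreducible `(𝔤,K)`-module data `(M, σK, σ𝔤)` (unitarity ∕ admissibility come from the representative of the class).
[cite: Rogawski1990, Prop. 15.2.1 (b) p. 249; BorelWallach2000, VI Thm. 4.11] -/
theorem eq_of_ofModule_eq_archDegOneClass' {M : Type} [AddCommGroup M] [Module ℂ M]
    (σK : Representation ℂ (uFormGroup (Fin 2) (Fin 1)).maximalCompact M) (σ𝔤 : (uFormGroup (Fin 2) (Fin 1)).lie →ₗ⁅ℝ⁆ Module.End ℂ M)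
    (hM : IsGKModule (uFormGroup (Fin 2) (Fin 1)) σK σ𝔤) (hirr : IsIrreducibleGK σK σ𝔤)
    {s : ℤ} (hs : s = 1 ∨ s = -1) (hcl : GKIrrClass.ofModule M σK σ𝔤 hM hirr = archDegOneClass s hs)
    (δ : ℤ) (hδ : δ = 1 ∨ δ = -1) (hne : upqTypeClasses σK σ𝔤 hM.ad_compat 1 δ ≠ ⊥) : δ = s := by
  obtain ⟨r, hr, hrs, hr_eq⟩ := archDegOneClass_spec s hs
  -- `M` is `(𝔤,K)`-equivalent to the representative `r`
  have hMr : AreGKEquivalent σK σ𝔤 r.ρK r.ρ𝔤 := by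
    rw [← GKIrrClass.mk_eq_mk_iff ⟨M, σK, σ𝔤, hM, hirr⟩ r, ← GKIrrClass.ofModule_eq_mk, hcl, hr_eq]
  obtain ⟨e⟩ := hMr
  -- transport the non-vanishing type-`δ` classes to `r`
  have hne' : upqTypeClasses r.ρK r.ρ𝔤 hr.gk.ad_compat 1 δ ≠ ⊥ := fun h0 =>
    hne ((upqTypeClasses_eq_bot_iff_of_equiv σK σ𝔤 hM.ad_compat r.ρK r.ρ𝔤 hr.gk.ad_compat e.toLinearEquiv e.comm𝔤 e.commK 1 δ).2 h0)
  have hcl' : GKIrrClass.ofModule r.V r.ρK r.ρ𝔤 hr.gk hr.irred = archDegOneClass s hs := by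
    rw [GKIrrClass.ofModule_eq_mk]; exact hr_eq
  exact eq_of_ofModule_eq_archDegOneClass r.ρK r.ρ𝔤 hr hs hcl' δ hδ hne'

/-- **Law `ArchPacketCoh` AT (`packInf₀`, `sgnInf₀`)** — the body of T5 v5's `ClassificationKit.ArchPacketCoh` (:479–484) with `packInf := packInf₀`,
`sgnInf := sgnInf₀`, GIVEN the two residual clauses: the degree-one classes of type `δ` on a member of `Π(ξ_ι)` live on `πⁿ(ξ_ι)` with `δ = sgnInf₀ ξ`.
[cite: Rogawski1990, §12.3 p. 178 (Prop. 12.3.3), Prop. 15.2.1 p. 249; BorelWallach2000, VI Thm. 4.11] -/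
theorem archPacketCoh_of (hJ : JInfNoDegOne jInf) (hD : DsInfNoDegOne dsInf) :
    ∀ (ξ : OneDimAutRepH L) (M : Type) [AddCommGroup M] [Module ℂ M]
      (σK : Representation ℂ (uFormGroup (Fin 2) (Fin 1)).maximalCompact M) (σ𝔤 : (uFormGroup (Fin 2) (Fin 1)).lie →ₗ⁅ℝ⁆ Module.End ℂ M)
      (hM : IsGKModule (uFormGroup (Fin 2) (Fin 1)) σK σ𝔤) (hirr : IsIrreducibleGK σK σ𝔤),
      GKIrrClass.ofModule M σK σ𝔤 hM hirr ∈ (archPacketOfRecord ι μω jInf dsInf ξ).members →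
      ∀ δ : ℤ, (δ = 1 ∨ δ = -1) → upqTypeClasses σK σ𝔤 hM.ad_compat 1 δ ≠ ⊥ → δ = sgnInfOfRecord ι μω ξ := by
  intro ξ M _ _ σK σ𝔤 hM hirr hmem δ hδ hne
  rcases (mem_archPacketOfRecord_iff jInf dsInf ι μω ξ _).1 hmem with hx | hx
  · by_cases h : ξ.IsCohTrivialAt (ArchSignRecipe.tOfArchType (archTypeOfRecord μω) ι) ι
    · rw [archPacketOfRecord_πn_of_isCohTrivialAt jInf dsInf ι μω ξ h] at hx
      exact eq_of_ofModule_eq_archDegOneClass' σK σ𝔤 hM hirr _ hx δ hδ hne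
    · rw [archPacketOfRecord_πn_of_not jInf dsInf ι μω ξ h] at hx
      exact absurd (hJ _ _ _ h M σK σ𝔤 hM hirr hx δ hδ) hne
  · exact absurd (hD _ _ _ M σK σ𝔤 hM hirr hx δ hδ) hne

/-- **Law `ArchMember μω` AT `packInf₀`** — the body of T5 v5's `ClassificationKit.ArchMember μω` (:491–498) with `packInf := packInf₀`, for unitary `μω`
with `μω|_{𝕀_{L⁺}} = ω_{L/L⁺}`, GIVEN the two residual clauses: if a member of `Π(ξ_ι)` carries a degree-one class of type `±1`, then `ξ_{ι′}` is of
cohomological type (trivial coefficients) at both embeddings `ι′` over `ι`, w.r.t. ANY unitary type `k` of `μω` (`k = k₀`, ★ `archTypeOfRecord_eq`).  On the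
locus no module argument is needed (the guard is the conclusion). [cite: Rogawski1990, §12.3 pp. 176–178 (Prop. 12.3.3), Prop. 15.2.1 (a) p. 249] -/
theorem archMember_of (hμu : μω.IsUnitary)
    (hμω : ∀ x : ideleGroup ↥(maximalRealSubfield L),
      μω (AdeleRing.ideleBaseChange (↥(maximalRealSubfield L)) L x) = quadraticHeckeCharCM L x)
    (hJ : JInfNoDegOne jInf) (hD : DsInfNoDegOne dsInf) :
    ∀ (ξ : OneDimAutRepH L) (k : InfinitePlace L → ℤ), μω.HasUnitaryArchType k (fun _ => 0) →
      ∀ (M : Type) [AddCommGroup M] [Module ℂ M]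
      (σK : Representation ℂ (uFormGroup (Fin 2) (Fin 1)).maximalCompact M) (σ𝔤 : (uFormGroup (Fin 2) (Fin 1)).lie →ₗ⁅ℝ⁆ Module.End ℂ M)
      (hM : IsGKModule (uFormGroup (Fin 2) (Fin 1)) σK σ𝔤) (hirr : IsIrreducibleGK σK σ𝔤),
      GKIrrClass.ofModule M σK σ𝔤 hM hirr ∈ (archPacketOfRecord ι μω jInf dsInf ξ).members →
      ∀ δ : ℤ, (δ = 1 ∨ δ = -1) → upqTypeClasses σK σ𝔤 hM.ad_compat 1 δ ≠ ⊥ →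
        ∀ ι' : L →+* ℂ, InfinitePlace.mk ι' = InfinitePlace.mk ι → ξ.IsCohTrivialAt (ArchSignRecipe.tOfArchType k ι') ι' := by
  intro ξ k hk M _ _ σK σ𝔤 hM hirr hmem δ hδ hne ι' hι'
  have hk₀ : archTypeOfRecord μω = k := archTypeOfRecord_eq hμu hk
  by_cases h : ξ.IsCohTrivialAt (ArchSignRecipe.tOfArchType (archTypeOfRecord μω) ι) ι
  · -- on the locus: the guard is the conclusion at `ι`, and at `ῑ` by conjugation invariance
    rw [hk₀] at h
    exact isCohTrivialAt_of_mk_eq ξ k (fun w => hk₀ ▸ odd_archTypeOfRecord μω hμu hμω w) ι h ι' hι'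
  · -- off the locus no member carries a degree-one class
    exfalso
    rcases (mem_archPacketOfRecord_iff jInf dsInf ι μω ξ _).1 hmem with hx | hx
    · rw [archPacketOfRecord_πn_of_not jInf dsInf ι μω ξ h] at hx
      exact hne (hJ _ _ _ h M σK σ𝔤 hM hirr hx δ hδ)
    · exact hne (hD _ _ _ M σK σ𝔤 hM hirr hx δ hδ)

/-- **Off the locus nothing in `Π(ξ_ι)` is cohomological** (residual clauses): a member with a non-zero degree-one class of type `±1` forces
`ξ.IsCohTrivialAt (tOfArchType k₀ ι) ι`. [cite: Rogawski1990, Prop. 15.2.1 p. 249] -/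
theorem isCohTrivialAt_of_mem_of_ne_bot (hJ : JInfNoDegOne jInf) (hD : DsInfNoDegOne dsInf) (ξ : OneDimAutRepH L)
    {M : Type} [AddCommGroup M] [Module ℂ M]
    (σK : Representation ℂ (uFormGroup (Fin 2) (Fin 1)).maximalCompact M) (σ𝔤 : (uFormGroup (Fin 2) (Fin 1)).lie →ₗ⁅ℝ⁆ Module.End ℂ M)
    (hM : IsGKModule (uFormGroup (Fin 2) (Fin 1)) σK σ𝔤) (hirr : IsIrreducibleGK σK σ𝔤)
    (hmem : GKIrrClass.ofModule M σK σ𝔤 hM hirr ∈ (archPacketOfRecord ι μω jInf dsInf ξ).members)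
    {δ : ℤ} (hδ : δ = 1 ∨ δ = -1) (hne : upqTypeClasses σK σ𝔤 hM.ad_compat 1 δ ≠ ⊥) :
    ξ.IsCohTrivialAt (ArchSignRecipe.tOfArchType (archTypeOfRecord μω) ι) ι := by
  by_contra h
  rcases (mem_archPacketOfRecord_iff jInf dsInf ι μω ξ _).1 hmem with hx | hx
  · rw [archPacketOfRecord_πn_of_not jInf dsInf ι μω ξ h] at hx
    exact hne (hJ _ _ _ h M σK σ𝔤 hM hirr hx δ hδ)
  · exact hne (hD _ _ _ M σK σ𝔤 hM hirr hx δ hδ)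

/-- … and then the member IS `πⁿ(ξ_ι) = [J^{sgnInf₀ ξ}]` and `δ = sgnInf₀ ξ = ξ.qψ ι`. [cite: Rogawski1990, §12.3 p. 178, Prop. 15.2.1 (b) p. 249] -/
theorem eq_πn_and_eq_sgnInf_of_mem_of_ne_bot (hJ : JInfNoDegOne jInf) (hD : DsInfNoDegOne dsInf) (ξ : OneDimAutRepH L)
    {M : Type} [AddCommGroup M] [Module ℂ M]
    (σK : Representation ℂ (uFormGroup (Fin 2) (Fin 1)).maximalCompact M) (σ𝔤 : (uFormGroup (Fin 2) (Fin 1)).lie →ₗ⁅ℝ⁆ Module.End ℂ M)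
    (hM : IsGKModule (uFormGroup (Fin 2) (Fin 1)) σK σ𝔤) (hirr : IsIrreducibleGK σK σ𝔤)
    (hmem : GKIrrClass.ofModule M σK σ𝔤 hM hirr ∈ (archPacketOfRecord ι μω jInf dsInf ξ).members)
    {δ : ℤ} (hδ : δ = 1 ∨ δ = -1) (hne : upqTypeClasses σK σ𝔤 hM.ad_compat 1 δ ≠ ⊥) :
    GKIrrClass.ofModule M σK σ𝔤 hM hirr = archDegOneClass (sgnInfOfRecord ι μω ξ) (sgnInfOfRecord_eq_one_or_eq_neg_one ι μω ξ) ∧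
      δ = sgnInfOfRecord ι μω ξ ∧ δ = ξ.qψ ι := by
  have h := isCohTrivialAt_of_mem_of_ne_bot jInf dsInf ι μω hJ hD ξ σK σ𝔤 hM hirr hmem hδ hne
  have hδs := archPacketCoh_of jInf dsInf ι μω hJ hD ξ M σK σ𝔤 hM hirr hmem δ hδ hne
  refine ⟨?_, hδs, hδs.trans (sgnInfOfRecord_eq_qψ_of_isCohTrivialAt ι μω ξ h)⟩
  rcases (mem_archPacketOfRecord_iff jInf dsInf ι μω ξ _).1 hmem with hx | hx
  · rwa [archPacketOfRecord_πn_of_isCohTrivialAt jInf dsInf ι μω ξ h] at hx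
  · exact absurd (hD _ _ _ M σK σ𝔤 hM hirr hx δ hδ) hne

end Summit.HodgeConjecture.HodgeConjecture.Cruxes.H413.F0P3XiArchPacketOfRecord

end
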